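import Summits.HubbardSuperconductivity.HubbardSuperconductivity.Theorems.NodalWardXYPerturbedXYOrderChargedShift

/-!
# `PerturbedXYOrder` (stmt-HubbardSuperconductivity-10739) — line `schwarz-inheritance`, stub `stub_energyTiltShift`

Tools for the NEGATIVE stub `stub_chargedEnergyTiltPinching` of lead c18 (the RELATIVELY BOUNDED charged tilt of the rotator is not
uniformly zero-free — `Theorems/PerturbedXYOrder/Negative/ChargedEnergyTiltPinching.lean`), over the vocabulary of
`Theorems/NodalWardXYDefs.lean`.  The tilt is `A(θ) = Σ_b (cos θ_{b₁} + cos θ_{b₂})(1 − cos ∇_bθ)` (`b = (b₁, b₂ = b₁ + e_i)`), its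
quarter-turn partner `B(θ) = Σ_b (sin θ_{b₁} + sin θ_{b₂})(1 − cos ∇_bθ)`, and `Z(η) = ∫_cube w_J e^{ηA}`:

* §A `stub_energyTiltShift` (registered stub) — rotating the field direction, `∫ w_J e^{η A(θ; u)} = ∫ w_J e^{η A(θ)}` with
  `A(θ; u) = Σ_b (cos(θ_{b₁}+u) + cos(θ_{b₂}+u))(1 − cos ∇_bθ)` (global rotation invariance `cfp_setIntegral_shift`, p151006); hence `Z` is even
  (`u = π`) and `∫ w_J e^{±ηB} = Z(η)` (`u = ∓π/2`); growth `‖Z(η)‖ ≤ e^{4‖η‖·#bonds} Z(0)`; the four-term identity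
  `4 Z(t) = ∫ w_J (e^{tA} + e^{−tA} + e^{tB} + e^{−tB})` for real `t`;
* §B elementary pointwise facts: the pinching inequality `cfe_pointwise`, `Σ_y (cos(α−θ_y) + cos(β−θ_y)) = (cos α + cos β)M₁ + (sin α + sin β)M₂`,
  `|A|, |B| ≤ 4·#bonds`, the RELATIVE (form) bound `|A| ≤ 2 Σ_b (1 − cos ∇_bθ)` (`cfe_abs_tilt_le_energy` — the structural size class of
  the crux's `W_K`), and `#bonds = 3L³`.
-/

noncomputable section

namespace Summit.HubbardSuperconductivity.HubbardSuperconductivity.Theorems.PerturbedXYOrder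

open MeasureTheory Literature.Probability.LatticeModels Metric Set
open Summit.HubbardSuperconductivity.HubbardSuperconductivity.Theses.NodalWardXY

variable {L : ℕ}

/-! ### A. Shifts, growth and the four-term identity -/


/-- `Re(e^{-ic} e^{ia}) = cos(a − c)`. -/
theorem cfe_re_exp_inv_mul (a c : ℝ) : (((Circle.exp c)⁻¹ * Circle.exp a : Circle) : ℂ).re = Real.cos (a - c) := by
  rw [← Circle.exp_neg, ← Circle.exp_add, neg_add_eq_sub, Circle.coe_exp, Complex.exp_ofReal_mul_I_re]

/-- **Rotating the field direction of the energy tilt**: for every `η ∈ ℂ` and `u ∈ ℝ`,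
`∫ w_J e^{η Σ_b (cos(θ_{b₁}+u) + cos(θ_{b₂}+u))(1 − cos ∇_bθ)} = ∫ w_J e^{η Σ_b (cos θ_{b₁} + cos θ_{b₂})(1 − cos ∇_bθ)}`
(global rotation invariance of the rotator state, `cfp_setIntegral_shift`). -/
theorem cfe_tilt_shift [NeZero L] (J u : ℝ) (η : ℂ) :
    ∫ θ in cube L, wJ J θ * Complex.exp (η * ∑ b : Bond L,
        ((Real.cos (θ b.1 + u) : ℂ) + (Real.cos (θ (b.1 + Pi.single b.2 1) + u) : ℂ)) *
          (1 - (Real.cos (θ (b.1 + Pi.single b.2 1) - θ b.1) : ℂ))) =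
      ∫ θ in cube L, wJ J θ * Complex.exp (η * ∑ b : Bond L,
        ((Real.cos (θ b.1) : ℂ) + (Real.cos (θ (b.1 + Pi.single b.2 1)) : ℂ)) *
          (1 - (Real.cos (θ (b.1 + Pi.single b.2 1) - θ b.1) : ℂ))) := by
  set F : (TorusSite 3 L → Circle) → ℂ := fun z =>
    Complex.exp (η * ∑ b : Bond L, ((((z b.1 : ℂ)).re : ℂ) + ((((z (b.1 + Pi.single b.2 1)) : ℂ)).re : ℂ)) *
      (1 - (((((z b.1)⁻¹ * z (b.1 + Pi.single b.2 1) : Circle)) : ℂ).re : ℂ))) with hF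
  have hFc : Continuous F := by
    refine Complex.continuous_exp.comp (continuous_const.mul ?_)
    refine continuous_finsetSum _ fun b _ => Continuous.mul ?_ ?_
    · refine Continuous.add ?_ ?_
      · exact Complex.continuous_ofReal.comp (Complex.continuous_re.comp
          (continuous_subtype_val.comp (continuous_apply b.1)))
      · exact Complex.continuous_ofReal.comp (Complex.continuous_re.comp
          (continuous_subtype_val.comp (continuous_apply (b.1 + Pi.single b.2 1))))
    · refine Continuous.sub continuous_const ?_
      exact Complex.continuous_ofReal.comp (Complex.continuous_re.comp
        (continuous_subtype_val.comp (((continuous_apply b.1).inv).mul (continuous_apply (b.1 + Pi.single b.2 1)))))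
  have key := cfp_setIntegral_shift (L := L) J u hFc
  simp only [hF, cfp_re_coe_exp, cfe_re_exp_inv_mul, add_sub_add_right_eq_sub] at key
  exact key

/-- STUB `stub_energyTiltShift` (registered on stmt-HubbardSuperconductivity-10739, line `schwarz-inheritance`, rev 16): **rotating the
field direction of the energy tilt does not change its partition function** — for all `J, u, L, η`,
`∫_cube w_J e^{η Σ_b (cos(θ_{b₁}+u) + cos(θ_{b₂}+u))(1 − cos ∇_bθ)} = ∫_cube w_J e^{η Σ_b (cos θ_{b₁} + cos θ_{b₂})(1 − cos ∇_bθ)}`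
(O(2)-invariance of the rotator state `w_J dθ`). [folklore] -/
theorem stub_energyTiltShift :
    ∀ (J u : ℝ) (L : ℕ) [NeZero L] (η : ℂ),
      (∫ θ in cube L, wJ J θ * Complex.exp (η * ∑ b : Bond L,
          ((Real.cos (θ b.1 + u) : ℂ) + (Real.cos (θ (b.1 + Pi.single b.2 1) + u) : ℂ)) *
            (1 - (Real.cos (θ (b.1 + Pi.single b.2 1) - θ b.1) : ℂ)))) =
        ∫ θ in cube L, wJ J θ * Complex.exp (η * ∑ b : Bond L,
          ((Real.cos (θ b.1) : ℂ) + (Real.cos (θ (b.1 + Pi.single b.2 1)) : ℂ)) *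
            (1 - (Real.cos (θ (b.1 + Pi.single b.2 1) - θ b.1) : ℂ))) :=
  fun J u _ _ η => cfe_tilt_shift J u η


/-- **Evenness** of the energy-tilted partition function (`θ ↦ θ + π`). -/
theorem cfe_tilt_neg [NeZero L] (J : ℝ) (η : ℂ) :
    ∫ θ in cube L, wJ J θ * Complex.exp (-η * ∑ b : Bond L,
        ((Real.cos (θ b.1) : ℂ) + (Real.cos (θ (b.1 + Pi.single b.2 1)) : ℂ)) *
          (1 - (Real.cos (θ (b.1 + Pi.single b.2 1) - θ b.1) : ℂ))) =
      ∫ θ in cube L, wJ J θ * Complex.exp (η * ∑ b : Bond L,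
        ((Real.cos (θ b.1) : ℂ) + (Real.cos (θ (b.1 + Pi.single b.2 1)) : ℂ)) *
          (1 - (Real.cos (θ (b.1 + Pi.single b.2 1) - θ b.1) : ℂ))) := by
  rw [← cfe_tilt_shift J Real.pi η]
  refine integral_congr_ae (ae_of_all _ fun θ => ?_)
  simp only [Real.cos_add_pi, Complex.ofReal_neg, ← neg_add, neg_mul, Finset.sum_neg_distrib, mul_neg]

/-- **Quarter turn** (`θ ↦ θ − π/2`): the sine version of the energy tilt has the same partition function. -/
theorem cfe_tilt_sin [NeZero L] (J : ℝ) (η : ℂ) :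
    ∫ θ in cube L, wJ J θ * Complex.exp (η * ∑ b : Bond L,
        ((Real.sin (θ b.1) : ℂ) + (Real.sin (θ (b.1 + Pi.single b.2 1)) : ℂ)) *
          (1 - (Real.cos (θ (b.1 + Pi.single b.2 1) - θ b.1) : ℂ))) =
      ∫ θ in cube L, wJ J θ * Complex.exp (η * ∑ b : Bond L,
        ((Real.cos (θ b.1) : ℂ) + (Real.cos (θ (b.1 + Pi.single b.2 1)) : ℂ)) *
          (1 - (Real.cos (θ (b.1 + Pi.single b.2 1) - θ b.1) : ℂ))) := by
  rw [← cfe_tilt_shift J (-(Real.pi / 2)) η]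
  refine integral_congr_ae (ae_of_all _ fun θ => ?_)
  simp only [← sub_eq_add_neg, Real.cos_sub_pi_div_two]

/-- **Quarter turn** (`θ ↦ θ + π/2`). -/
theorem cfe_tilt_neg_sin [NeZero L] (J : ℝ) (η : ℂ) :
    ∫ θ in cube L, wJ J θ * Complex.exp (-η * ∑ b : Bond L,
        ((Real.sin (θ b.1) : ℂ) + (Real.sin (θ (b.1 + Pi.single b.2 1)) : ℂ)) *
          (1 - (Real.cos (θ (b.1 + Pi.single b.2 1) - θ b.1) : ℂ))) =
      ∫ θ in cube L, wJ J θ * Complex.exp (η * ∑ b : Bond L,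
        ((Real.cos (θ b.1) : ℂ) + (Real.cos (θ (b.1 + Pi.single b.2 1)) : ℂ)) *
          (1 - (Real.cos (θ (b.1 + Pi.single b.2 1) - θ b.1) : ℂ))) := by
  rw [← cfe_tilt_shift J (Real.pi / 2) η]
  refine integral_congr_ae (ae_of_all _ fun θ => ?_)
  simp only [Real.cos_add_pi_div_two, Complex.ofReal_neg, ← neg_add, neg_mul, Finset.sum_neg_distrib, mul_neg]

/-- The energy tilt is bounded by `4` per bond (as a complex number). -/
theorem cfe_norm_tilt_le [NeZero L] (f : ℝ → ℝ) (hf : ∀ s, |f s| ≤ 1) (θ : TorusSite 3 L → ℝ) :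
    ‖∑ b : Bond L, ((f (θ b.1) : ℂ) + (f (θ (b.1 + Pi.single b.2 1)) : ℂ)) *
        (1 - (Real.cos (θ (b.1 + Pi.single b.2 1) - θ b.1) : ℂ))‖ ≤ 4 * ∑ _b : Bond L, (1 : ℝ) := by
  rw [Finset.mul_sum]
  refine (norm_sum_le _ _).trans (Finset.sum_le_sum fun b _ => ?_)
  rw [norm_mul]
  have h1 : ‖((f (θ b.1) : ℂ) + (f (θ (b.1 + Pi.single b.2 1)) : ℂ))‖ ≤ 2 := by
    refine (norm_add_le _ _).trans ?_
    rw [Complex.norm_real, Complex.norm_real, Real.norm_eq_abs, Real.norm_eq_abs]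
    linarith [hf (θ b.1), hf (θ (b.1 + Pi.single b.2 1))]
  have h2 : ‖(1 : ℂ) - (Real.cos (θ (b.1 + Pi.single b.2 1) - θ b.1) : ℂ)‖ ≤ 2 := by
    refine (norm_sub_le _ _).trans ?_
    rw [Complex.norm_real, Real.norm_eq_abs, norm_one]
    linarith [Real.abs_cos_le_one (θ (b.1 + Pi.single b.2 1) - θ b.1)]
  calc ‖((f (θ b.1) : ℂ) + (f (θ (b.1 + Pi.single b.2 1)) : ℂ))‖ *
        ‖(1 : ℂ) - (Real.cos (θ (b.1 + Pi.single b.2 1) - θ b.1) : ℂ)‖ ≤ 2 * 2 :=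
        mul_le_mul h1 h2 (norm_nonneg _) zero_le_two
    _ = 4 * 1 := by norm_num

/-- **Growth** of the energy-tilted partition function: `‖∫ w_J e^{η T}‖ ≤ e^{4‖η‖ #bonds} ∫ w_J`. -/
theorem cfe_norm_Ztilt_le [NeZero L] (J : ℝ) (η : ℂ) :
    ‖∫ θ in cube L, wJ J θ * Complex.exp (η * ∑ b : Bond L,
        ((Real.cos (θ b.1) : ℂ) + (Real.cos (θ (b.1 + Pi.single b.2 1)) : ℂ)) *
          (1 - (Real.cos (θ (b.1 + Pi.single b.2 1) - θ b.1) : ℂ)))‖ ≤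
      Real.exp (‖η‖ * (4 * ∑ _b : Bond L, (1 : ℝ))) *
        ∫ θ in cube L, Real.exp (J * ∑ b : Bond L, Real.cos (θ (b.1 + Pi.single b.2 1) - θ b.1)) := by
  rw [← integral_const_mul]
  refine norm_integral_le_of_norm_le (((continuous_xyWeight J).continuousOn.integrableOn_compact
    ent_isCompact_cube).const_mul _) (ae_of_all _ fun θ => ?_)
  rw [norm_mul]
  have hw : ‖wJ J θ‖ = Real.exp (J * ∑ b : Bond L, Real.cos (θ (b.1 + Pi.single b.2 1) - θ b.1)) := by
    unfold wJ; rw [Complex.norm_real, Real.norm_eq_abs, Real.abs_exp]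
  rw [hw, mul_comm]
  refine mul_le_mul_of_nonneg_right ?_ (Real.exp_pos _).le
  refine (Complex.norm_exp_le_exp_norm _).trans (Real.exp_le_exp.2 ?_)
  rw [norm_mul]
  exact mul_le_mul_of_nonneg_left (cfe_norm_tilt_le Real.cos Real.abs_cos_le_one θ) (norm_nonneg _)

/-- **Four-term identity** for the energy tilt: for real `t`,
`4 ∫ w_J e^{tA} = ∫ w_J (e^{tA} + e^{−tA} + e^{tB} + e^{−tB})`, `A, B` the cosine / sine energy tilts (a real integral). -/
theorem cfe_four_Ztilt [NeZero L] (J t : ℝ) :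
    4 * ∫ θ in cube L, wJ J θ * Complex.exp ((t : ℂ) * ∑ b : Bond L,
        ((Real.cos (θ b.1) : ℂ) + (Real.cos (θ (b.1 + Pi.single b.2 1)) : ℂ)) *
          (1 - (Real.cos (θ (b.1 + Pi.single b.2 1) - θ b.1) : ℂ))) =
      ((∫ θ in cube L, Real.exp (J * ∑ b : Bond L, Real.cos (θ (b.1 + Pi.single b.2 1) - θ b.1)) *
        (Real.exp (t * ∑ b : Bond L, (Real.cos (θ b.1) + Real.cos (θ (b.1 + Pi.single b.2 1))) *
            (1 - Real.cos (θ (b.1 + Pi.single b.2 1) - θ b.1))) +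
          Real.exp (-(t * ∑ b : Bond L, (Real.cos (θ b.1) + Real.cos (θ (b.1 + Pi.single b.2 1))) *
            (1 - Real.cos (θ (b.1 + Pi.single b.2 1) - θ b.1)))) +
          Real.exp (t * ∑ b : Bond L, (Real.sin (θ b.1) + Real.sin (θ (b.1 + Pi.single b.2 1))) *
            (1 - Real.cos (θ (b.1 + Pi.single b.2 1) - θ b.1))) +
          Real.exp (-(t * ∑ b : Bond L, (Real.sin (θ b.1) + Real.sin (θ (b.1 + Pi.single b.2 1))) *
            (1 - Real.cos (θ (b.1 + Pi.single b.2 1) - θ b.1))))) : ℝ) : ℂ) := by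
  -- integrability of the four tilted integrands
  have hint : ∀ (c : ℂ) (g : ℝ → ℝ), Continuous g →
      Integrable (fun θ : TorusSite 3 L → ℝ => wJ J θ * Complex.exp (c * ∑ b : Bond L,
        ((g (θ b.1) : ℂ) + (g (θ (b.1 + Pi.single b.2 1)) : ℂ)) *
          (1 - (Real.cos (θ (b.1 + Pi.single b.2 1) - θ b.1) : ℂ)))) (volume.restrict (cube L)) := by
    intro c g hg
    refine Continuous.continuousOn ?_ |>.integrableOn_compact ent_isCompact_cube
    refine (ent_continuous_wJ J).mul (Complex.continuous_exp.comp (continuous_const.mul ?_))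
    refine continuous_finsetSum _ fun b _ => Continuous.mul ?_ (by fun_prop)
    exact (Complex.continuous_ofReal.comp (hg.comp (continuous_apply _))).add
      (Complex.continuous_ofReal.comp (hg.comp (continuous_apply _)))
  have h1 := hint (t : ℂ) Real.cos Real.continuous_cos
  have h2 := hint (-(t : ℂ)) Real.cos Real.continuous_cos
  have h3 := hint (t : ℂ) Real.sin Real.continuous_sin
  have h4 := hint (-(t : ℂ)) Real.sin Real.continuous_sin
  -- real and complex exponentials
  have hcast : ∀ (g : ℝ → ℝ) (θ : TorusSite 3 L → ℝ),
      (∑ b : Bond L, ((g (θ b.1) : ℂ) + (g (θ (b.1 + Pi.single b.2 1)) : ℂ)) *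
          (1 - (Real.cos (θ (b.1 + Pi.single b.2 1) - θ b.1) : ℂ))) =
        ((∑ b : Bond L, (g (θ b.1) + g (θ (b.1 + Pi.single b.2 1))) *
          (1 - Real.cos (θ (b.1 + Pi.single b.2 1) - θ b.1)) : ℝ) : ℂ) := by
    intro g θ
    push_cast
    rfl
  have hpos : ∀ (g : ℝ → ℝ) (θ : TorusSite 3 L → ℝ),
      Complex.exp ((t : ℂ) * ∑ b : Bond L, ((g (θ b.1) : ℂ) + (g (θ (b.1 + Pi.single b.2 1)) : ℂ)) *
          (1 - (Real.cos (θ (b.1 + Pi.single b.2 1) - θ b.1) : ℂ))) =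
        ((Real.exp (t * ∑ b : Bond L, (g (θ b.1) + g (θ (b.1 + Pi.single b.2 1))) *
          (1 - Real.cos (θ (b.1 + Pi.single b.2 1) - θ b.1))) : ℝ) : ℂ) := by
    intro g θ
    rw [hcast, Complex.ofReal_exp]
    push_cast
    rfl
  have hneg : ∀ (g : ℝ → ℝ) (θ : TorusSite 3 L → ℝ),
      Complex.exp (-(t : ℂ) * ∑ b : Bond L, ((g (θ b.1) : ℂ) + (g (θ (b.1 + Pi.single b.2 1)) : ℂ)) *
          (1 - (Real.cos (θ (b.1 + Pi.single b.2 1) - θ b.1) : ℂ))) =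
        ((Real.exp (-(t * ∑ b : Bond L, (g (θ b.1) + g (θ (b.1 + Pi.single b.2 1))) *
          (1 - Real.cos (θ (b.1 + Pi.single b.2 1) - θ b.1)))) : ℝ) : ℂ) := by
    intro g θ
    rw [hcast, Complex.ofReal_exp]
    congr 1
    push_cast
    ring
  have e1 := cfe_tilt_neg (L := L) J (t : ℂ)
  have e2 := cfe_tilt_sin (L := L) J (t : ℂ)
  have e3 := cfe_tilt_neg_sin (L := L) J (t : ℂ)
  have h12 : Integrable (fun θ : TorusSite 3 L → ℝ =>
      wJ J θ * Complex.exp ((t : ℂ) * ∑ b : Bond L, ((Real.cos (θ b.1) : ℂ) + (Real.cos (θ (b.1 + Pi.single b.2 1)) : ℂ)) *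
        (1 - (Real.cos (θ (b.1 + Pi.single b.2 1) - θ b.1) : ℂ))) +
      wJ J θ * Complex.exp (-(t : ℂ) * ∑ b : Bond L, ((Real.cos (θ b.1) : ℂ) + (Real.cos (θ (b.1 + Pi.single b.2 1)) : ℂ)) *
        (1 - (Real.cos (θ (b.1 + Pi.single b.2 1) - θ b.1) : ℂ)))) (volume.restrict (cube L)) := h1.add h2
  have h123 : Integrable (fun θ : TorusSite 3 L → ℝ =>
      wJ J θ * Complex.exp ((t : ℂ) * ∑ b : Bond L, ((Real.cos (θ b.1) : ℂ) + (Real.cos (θ (b.1 + Pi.single b.2 1)) : ℂ)) *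
        (1 - (Real.cos (θ (b.1 + Pi.single b.2 1) - θ b.1) : ℂ))) +
      wJ J θ * Complex.exp (-(t : ℂ) * ∑ b : Bond L, ((Real.cos (θ b.1) : ℂ) + (Real.cos (θ (b.1 + Pi.single b.2 1)) : ℂ)) *
        (1 - (Real.cos (θ (b.1 + Pi.single b.2 1) - θ b.1) : ℂ))) +
      wJ J θ * Complex.exp ((t : ℂ) * ∑ b : Bond L, ((Real.sin (θ b.1) : ℂ) + (Real.sin (θ (b.1 + Pi.single b.2 1)) : ℂ)) *
        (1 - (Real.cos (θ (b.1 + Pi.single b.2 1) - θ b.1) : ℂ)))) (volume.restrict (cube L)) := h12.add h3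
  calc 4 * ∫ θ in cube L, wJ J θ * Complex.exp ((t : ℂ) * ∑ b : Bond L,
        ((Real.cos (θ b.1) : ℂ) + (Real.cos (θ (b.1 + Pi.single b.2 1)) : ℂ)) *
          (1 - (Real.cos (θ (b.1 + Pi.single b.2 1) - θ b.1) : ℂ)))
      = (∫ θ in cube L, wJ J θ * Complex.exp ((t : ℂ) * ∑ b : Bond L,
          ((Real.cos (θ b.1) : ℂ) + (Real.cos (θ (b.1 + Pi.single b.2 1)) : ℂ)) *
            (1 - (Real.cos (θ (b.1 + Pi.single b.2 1) - θ b.1) : ℂ)))) +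
        (∫ θ in cube L, wJ J θ * Complex.exp (-(t : ℂ) * ∑ b : Bond L,
          ((Real.cos (θ b.1) : ℂ) + (Real.cos (θ (b.1 + Pi.single b.2 1)) : ℂ)) *
            (1 - (Real.cos (θ (b.1 + Pi.single b.2 1) - θ b.1) : ℂ)))) +
        (∫ θ in cube L, wJ J θ * Complex.exp ((t : ℂ) * ∑ b : Bond L,
          ((Real.sin (θ b.1) : ℂ) + (Real.sin (θ (b.1 + Pi.single b.2 1)) : ℂ)) *
            (1 - (Real.cos (θ (b.1 + Pi.single b.2 1) - θ b.1) : ℂ)))) +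
        (∫ θ in cube L, wJ J θ * Complex.exp (-(t : ℂ) * ∑ b : Bond L,
          ((Real.sin (θ b.1) : ℂ) + (Real.sin (θ (b.1 + Pi.single b.2 1)) : ℂ)) *
            (1 - (Real.cos (θ (b.1 + Pi.single b.2 1) - θ b.1) : ℂ)))) := by
        rw [e1, e2, e3]; ring
    _ = ∫ θ in cube L, (wJ J θ * Complex.exp ((t : ℂ) * ∑ b : Bond L,
          ((Real.cos (θ b.1) : ℂ) + (Real.cos (θ (b.1 + Pi.single b.2 1)) : ℂ)) *
            (1 - (Real.cos (θ (b.1 + Pi.single b.2 1) - θ b.1) : ℂ))) +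
        wJ J θ * Complex.exp (-(t : ℂ) * ∑ b : Bond L,
          ((Real.cos (θ b.1) : ℂ) + (Real.cos (θ (b.1 + Pi.single b.2 1)) : ℂ)) *
            (1 - (Real.cos (θ (b.1 + Pi.single b.2 1) - θ b.1) : ℂ))) +
        wJ J θ * Complex.exp ((t : ℂ) * ∑ b : Bond L,
          ((Real.sin (θ b.1) : ℂ) + (Real.sin (θ (b.1 + Pi.single b.2 1)) : ℂ)) *
            (1 - (Real.cos (θ (b.1 + Pi.single b.2 1) - θ b.1) : ℂ))) +
        wJ J θ * Complex.exp (-(t : ℂ) * ∑ b : Bond L,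
          ((Real.sin (θ b.1) : ℂ) + (Real.sin (θ (b.1 + Pi.single b.2 1)) : ℂ)) *
            (1 - (Real.cos (θ (b.1 + Pi.single b.2 1) - θ b.1) : ℂ)))) := by
        rw [integral_add h123 h4, integral_add h12 h3, integral_add h1 h2]
    _ = _ := by
        rw [← integral_complex_ofReal]
        refine integral_congr_ae (ae_of_all _ fun θ => ?_)
        dsimp only
        rw [hpos Real.cos θ, hpos Real.sin θ, hneg Real.cos θ, hneg Real.sin θ]
        unfold wJ
        push_cast
        ring

/-! ### B. Pointwise facts -/

/-- Pointwise pinching for the energy tilt: if `R ≤ N(|A| + |B|)` and `|A| + |B| ≤ C` then for `t, s ≥ 0`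
`e^{ts/2} (R − sN)/(NC) ≤ e^{tA} + e^{−tA} + e^{tB} + e^{−tB}` (on `R > sN` one has `|A| + |B| > s`, and
`e^{t|A|} + e^{t|B|} ≥ 2 e^{t(|A|+|B|)/2}`). -/
theorem cfe_pointwise {A B R N C s t : ℝ} (ht : 0 ≤ t) (hs : 0 ≤ s) (hN : 0 < N) (hC : 0 < C)
    (hR : R ≤ N * (|A| + |B|)) (hAB : |A| + |B| ≤ C) :
    Real.exp (t * s / 2) * ((R - s * N) / (N * C)) ≤
      Real.exp (t * A) + Real.exp (-(t * A)) + Real.exp (t * B) + Real.exp (-(t * B)) := by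
  have h4pos : 0 < Real.exp (t * A) + Real.exp (-(t * A)) + Real.exp (t * B) + Real.exp (-(t * B)) := by
    positivity
  by_cases h : R - s * N ≤ 0
  · have : Real.exp (t * s / 2) * ((R - s * N) / (N * C)) ≤ 0 :=
      mul_nonpos_iff.2 (Or.inl ⟨(Real.exp_pos _).le, div_nonpos_of_nonpos_of_nonneg h (by positivity)⟩)
    linarith
  push Not at h
  have hNC : 0 < N * C := by positivity
  -- `|A| + |B| > s`
  have hABs : s < |A| + |B| := by
    by_contra hcon
    push Not at hcon
    have : R ≤ N * s := hR.trans (mul_le_mul_of_nonneg_left hcon hN.le)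
    linarith
  -- the factor is at most `1`
  have hfac : (R - s * N) / (N * C) ≤ 1 := by
    rw [div_le_one hNC]
    have : R ≤ N * C := hR.trans (mul_le_mul_of_nonneg_left hAB hN.le)
    nlinarith
  -- `e^{t|A|} ≤ e^{tA} + e^{-tA}`, and the same for `B`
  have habsA : Real.exp (t * |A|) ≤ Real.exp (t * A) + Real.exp (-(t * A)) := by
    rcases abs_choice A with h' | h' <;> rw [h']
    · linarith [Real.exp_pos (-(t * A))]
    · rw [mul_neg]; linarith [Real.exp_pos (t * A)]
  have habsB : Real.exp (t * |B|) ≤ Real.exp (t * B) + Real.exp (-(t * B)) := by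
    rcases abs_choice B with h' | h' <;> rw [h']
    · linarith [Real.exp_pos (-(t * B))]
    · rw [mul_neg]; linarith [Real.exp_pos (t * B)]
  -- AM–GM: `e^{a} + e^{b} ≥ 2 e^{(a+b)/2}`
  have hamgm : 2 * Real.exp (t * (|A| + |B|) / 2) ≤ Real.exp (t * |A|) + Real.exp (t * |B|) := by
    have hA2 : Real.exp (t * |A|) = Real.exp (t * |A| / 2) ^ 2 := by
      rw [sq, ← Real.exp_add]; ring_nf
    have hB2 : Real.exp (t * |B|) = Real.exp (t * |B| / 2) ^ 2 := by
      rw [sq, ← Real.exp_add]; ring_nf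
    have hm : Real.exp (t * (|A| + |B|) / 2) = Real.exp (t * |A| / 2) * Real.exp (t * |B| / 2) := by
      rw [← Real.exp_add]; ring_nf
    rw [hA2, hB2, hm]
    nlinarith [sq_nonneg (Real.exp (t * |A| / 2) - Real.exp (t * |B| / 2))]
  have hmono : Real.exp (t * s / 2) ≤ Real.exp (t * (|A| + |B|) / 2) := by
    refine Real.exp_le_exp.2 ?_
    have := mul_le_mul_of_nonneg_left hABs.le ht
    linarith
  calc Real.exp (t * s / 2) * ((R - s * N) / (N * C)) ≤ Real.exp (t * s / 2) * 1 :=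
        mul_le_mul_of_nonneg_left hfac (Real.exp_pos _).le
    _ ≤ 2 * Real.exp (t * (|A| + |B|) / 2) := by linarith [Real.exp_pos (t * (|A| + |B|) / 2)]
    _ ≤ Real.exp (t * |A|) + Real.exp (t * |B|) := hamgm
    _ ≤ _ := by linarith

/-- `Σ_y (cos(α − θ_y) + cos(β − θ_y)) = (cos α + cos β) Σ_y cos θ_y + (sin α + sin β) Σ_y sin θ_y`. -/
theorem cfe_sum_cos_sub_pair [NeZero L] (θ : TorusSite 3 L → ℝ) (α β : ℝ) :
    ∑ y : TorusSite 3 L, (Real.cos (α - θ y) + Real.cos (β - θ y)) =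
      (Real.cos α + Real.cos β) * ∑ y : TorusSite 3 L, Real.cos (θ y) +
        (Real.sin α + Real.sin β) * ∑ y : TorusSite 3 L, Real.sin (θ y) := by
  rw [Finset.mul_sum, Finset.mul_sum, ← Finset.sum_add_distrib]
  refine Finset.sum_congr rfl fun y _ => ?_
  rw [Real.cos_sub, Real.cos_sub]
  ring

/-- `|A| ≤ 4 · #bonds` for the cosine / sine energy tilt. -/
theorem cfe_abs_tilt_le [NeZero L] (f : ℝ → ℝ) (hf : ∀ s, |f s| ≤ 1) (θ : TorusSite 3 L → ℝ) :
    |∑ b : Bond L, (f (θ b.1) + f (θ (b.1 + Pi.single b.2 1))) * (1 - Real.cos (θ (b.1 + Pi.single b.2 1) - θ b.1))| ≤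
      4 * ∑ _b : Bond L, (1 : ℝ) := by
  rw [Finset.mul_sum]
  refine (Finset.abs_sum_le_sum_abs _ _).trans (Finset.sum_le_sum fun b _ => ?_)
  rw [abs_mul]
  have h1 : |f (θ b.1) + f (θ (b.1 + Pi.single b.2 1))| ≤ 2 := by
    refine (abs_add_le _ _).trans ?_
    linarith [hf (θ b.1), hf (θ (b.1 + Pi.single b.2 1))]
  have h2 : |1 - Real.cos (θ (b.1 + Pi.single b.2 1) - θ b.1)| ≤ 2 := by
    rw [abs_le]
    constructor <;> linarith [Real.cos_le_one (θ (b.1 + Pi.single b.2 1) - θ b.1),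
      Real.neg_one_le_cos (θ (b.1 + Pi.single b.2 1) - θ b.1)]
  calc |f (θ b.1) + f (θ (b.1 + Pi.single b.2 1))| * |1 - Real.cos (θ (b.1 + Pi.single b.2 1) - θ b.1)| ≤ 2 * 2 :=
        mul_le_mul h1 h2 (abs_nonneg _) zero_le_two
    _ = 4 * 1 := by norm_num

/-- **The energy tilt is RELATIVELY (form-)bounded**: `|A(θ)| ≤ 2 Σ_b (1 − cos ∇_bθ)` — the structural property the crux's
informal statement advertises for `W_K` (Balaban's small/large-field condition without the `|Λ|` term); so the tilt refuted below is
in every size class of the crux except O(2)-invariance. -/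
theorem cfe_abs_tilt_le_energy [NeZero L] (θ : TorusSite 3 L → ℝ) :
    |∑ b : Bond L, (Real.cos (θ b.1) + Real.cos (θ (b.1 + Pi.single b.2 1))) *
        (1 - Real.cos (θ (b.1 + Pi.single b.2 1) - θ b.1))| ≤
      2 * ∑ b : Bond L, (1 - Real.cos (θ (b.1 + Pi.single b.2 1) - θ b.1)) := by
  rw [Finset.mul_sum]
  refine (Finset.abs_sum_le_sum_abs _ _).trans (Finset.sum_le_sum fun b _ => ?_)
  rw [abs_mul, abs_of_nonneg (by linarith [Real.cos_le_one (θ (b.1 + Pi.single b.2 1) - θ b.1)] :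
    (0 : ℝ) ≤ 1 - Real.cos (θ (b.1 + Pi.single b.2 1) - θ b.1))]
  refine mul_le_mul_of_nonneg_right ((abs_add_le _ _).trans ?_)
    (by linarith [Real.cos_le_one (θ (b.1 + Pi.single b.2 1) - θ b.1)])
  linarith [Real.abs_cos_le_one (θ b.1), Real.abs_cos_le_one (θ (b.1 + Pi.single b.2 1)),
    le_abs_self (Real.cos (θ b.1)), le_abs_self (Real.cos (θ (b.1 + Pi.single b.2 1)))]

/-- The number of directed bonds is `3 L³`. -/
theorem cfe_sum_bond_one [NeZero L] : ∑ _b : Bond L, (1 : ℝ) = 3 * (L : ℝ) ^ 3 := by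
  rw [Finset.sum_const, Finset.card_univ, nsmul_eq_mul, mul_one]
  simp only [Fintype.card_prod, Fintype.card_fun, Fintype.card_fin, ZMod.card]
  push_cast; ring

end Summit.HubbardSuperconductivity.HubbardSuperconductivity.Theorems.PerturbedXYOrder

end
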